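import Summits.Parity.GeneralizedHardyLittlewood.Theorems.PrimeLevelFamEdgeMomentsBeyondDiagonalLayersFormReduction
import Summits.Parity.GeneralizedHardyLittlewood.Theorems.PrimeLevelFamEdgeMomentsBeyondDiagonalLayersHigherTaylor
import HarnessLib

/-!
# Route `PrimeLevelFamEdge`, crux K_A `MomentsBeyondDiagonal` (stmt-Parity-20007), line «petersson_layers» v4:
# `stub_farP` REDUCED TO THE LEADING TAYLOR ORDER — only the `k = 0` bilinear Kloosterman forms need cancellation

Fifth layer of the top-down assembly (after `…LayersFormReduction.subFar_rhoP_of_form_bound`; the trivial bound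
`Σ_{d₁,d₂}‖Form_k‖ ≤ 4qr·B²KL(1+2log q)(M²Y)^{k+1}` is `…LayersHigherTaylor.sum_norm_form_le_trivial`):
* §1 the scales: `L(1+2log q) ≤ C q̂^{1/100}`, `M²Y ≤ 2q̂^{403/100}` on `Δ' ≤ 101/100`, `η ≤ 1/100`, and
  `q̂^{2/100 + (403/100)(k+1)} ≤ q^{2k+1} r^{2k}` for `k ≥ 1`, `r > q̂^{11/10}` (exponent check `4.05 + 4.03k ≤ 6.2k + 2`);
* §2 `sum_norm_form_le_of_one_le`: for every `k ≥ 1` the hypothesis of `subFar_rhoP_of_form_bound` holds with `δ = 1/100`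
  UNCONDITIONALLY (no cancellation in the Kloosterman sums is used);
* §3 **`subFar_rhoP_of_form_bound_zero`**: `SubFar rhoP` (the registered signature of `stub_farP`) ⟸ on a window
  `(1, Δ₀] ⊆ (1, 101/100]`, for every admissible `P` and `Δ'`: ONE `δ > 0`, ONE `η ∈ (0, 1/100]` and, per order `(i, j)`,
  constants `A, q₀` with, on the band `⌊q̂^{ρ_P}⌋ < r ≤ ⌊q̂^{ρ_W}⌋` (primes `q ≥ q₀`, `q̂^{Δ'} ∉ ℕ`),
  `Σ_{d₁,d₂ ≤ M} ‖Σ_{m₁',n₁',m₂',n₂'} [x_{d₁m₁'}x_{d₂m₂'}√m₁'√m₂'] [1_{d₁n₁'d₂n₂'≤Y}(d₁n₁'d₂n₂')^{−1/2}W_{ij}(d₁n₁',d₂n₂')√n₁'√n₂']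
    S(m₁'n₁', m₂'n₂'; qr)‖ ≤ A · q̂^{−δ} · (qr)² · r⁻¹`   (`M = ⌊q̂^{Δ'}⌋`, `Y = ⌈q̂^{2+η}⌉`).
  This is the ONE place where the line needs a bound beyond the Parseval floor (Pascadi's Thm 7.1 in the print band,
  after the sharp-data classification — remaining steps E3–E7 of the census on the crux item; NOT done here).
Proof only (def-free helper); K_A NOT proved; nothing about Landau–Siegel zeros.
-/

noncomputable section

open scoped Real Nat
open Complex Finset Polynomial MeasureTheory
open Literature.NumberTheory.LFunctions

namespace Summit.Parity.GeneralizedHardyLittlewood.Theorems.MomentsBeyondDiagonal.Layers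

open Summit.Parity.GeneralizedHardyLittlewood.Theorems.PrimeLevelFamEdgeIdeaDeltas.PeterssonLayers
open Summit.Parity.GeneralizedHardyLittlewood.Theorems.MomentsBeyondDiagonal.TwoOrderAFE
  (one_add_two_log_le one_add_log_pow_le_rpow)

/-! ## §1. The scales -/

/-- **The log factors are sub-power**: `((1+log q̂)(1+2log q))^{i+j} · (1+2log q) ≤ C · q̂^{1/100}` for `q ≥ 64`.
[folklore] -/
theorem logFactor_mul_le_rpow (i j : ℕ) :
    ∃ C : ℝ, 0 ≤ C ∧ ∀ (q : ℕ) [NeZero q], 64 ≤ q →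
      ((1 + Real.log (KMV2000.qhat q)) * (1 + 2 * Real.log q)) ^ (i + j) * (1 + 2 * Real.log q) ≤
        C * KMV2000.qhat q ^ (1 / 100 : ℝ) := by
  set n : ℕ := 2 * (i + j) + 1 with hn
  set ε : ℝ := 1 / (100 * n) with hεdef
  have hn0 : (0 : ℝ) < n := by rw [hn]; positivity
  have hε : 0 < ε := by rw [hεdef]; positivity
  refine ⟨9 ^ (i + j + 1) * (1 + ε⁻¹) ^ n, by positivity, fun q _ hq ↦ ?_⟩
  have hqh1 : 1 < KMV2000.qhat q := one_lt_qhat hq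
  have hlq : 0 ≤ Real.log (q : ℝ) :=
    Real.log_nonneg (by exact_mod_cast (le_trans (by norm_num) hq : 1 ≤ q))
  set x : ℝ := KMV2000.qhat q with hx
  have hL0 : 0 ≤ 1 + Real.log x := by linarith [Real.log_nonneg hqh1.le]
  have h9 := one_add_two_log_le (q := q) hq
  have hpow := one_add_log_pow_le_rpow hε n hqh1.le
  have hexp : ε * (n : ℝ) = 1 / 100 := by
    rw [hεdef]; field_simp
  rw [hexp] at hpow
  have hsq : (1 + Real.log x) * (9 * (1 + Real.log x)) = 9 * (1 + Real.log x) ^ 2 := by ring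
  calc ((1 + Real.log x) * (1 + 2 * Real.log q)) ^ (i + j) * (1 + 2 * Real.log q)
      ≤ ((1 + Real.log x) * (9 * (1 + Real.log x))) ^ (i + j) * (9 * (1 + Real.log x)) :=
        mul_le_mul (pow_le_pow_left₀ (mul_nonneg hL0 (by linarith)) (mul_le_mul_of_nonneg_left h9 hL0) _) h9
          (by linarith) (by positivity)
    _ = 9 ^ (i + j + 1) * (1 + Real.log x) ^ n := by
        rw [hn, hsq, mul_pow, ← pow_mul, pow_succ (9 : ℝ) (i + j), pow_succ (1 + Real.log x) (2 * (i + j))]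
        ring
    _ ≤ 9 ^ (i + j + 1) * ((1 + ε⁻¹) ^ n * x ^ (1 / 100 : ℝ)) := mul_le_mul_of_nonneg_left hpow (by positivity)
    _ = _ := by ring

/-- **The effective box is short on the window**: `M²·Y ≤ 2 q̂^{403/100}` for `Δ' ≤ 101/100`, `η ≤ 1/100` (`q ≥ 64`). [folklore] -/
theorem box_product_le {q : ℕ} [NeZero q] (hq : 64 ≤ q) {Δ' η : ℝ} (hΔ' : Δ' ≤ 101 / 100) (hη0 : 0 ≤ η)
    (hη : η ≤ 1 / 100) :
    (((⌊KMV2000.qhat q ^ Δ'⌋₊ : ℕ) : ℝ)) ^ 2 * ((⌈KMV2000.qhat q ^ (2 + η)⌉₊ : ℕ) : ℝ) ≤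
      2 * KMV2000.qhat q ^ (403 / 100 : ℝ) := by
  have hqh1 : 1 < KMV2000.qhat q := one_lt_qhat hq
  have hqh0 : 0 < KMV2000.qhat q := zero_lt_one.trans hqh1
  set x : ℝ := KMV2000.qhat q with hx
  have hM : ((⌊x ^ Δ'⌋₊ : ℕ) : ℝ) ≤ x ^ (101 / 100 : ℝ) :=
    (Nat.floor_le (Real.rpow_nonneg hqh0.le _)).trans (Real.rpow_le_rpow_of_exponent_le hqh1.le hΔ')
  have hM2 : (((⌊x ^ Δ'⌋₊ : ℕ) : ℝ)) ^ 2 ≤ x ^ (202 / 100 : ℝ) := by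
    calc (((⌊x ^ Δ'⌋₊ : ℕ) : ℝ)) ^ 2 ≤ (x ^ (101 / 100 : ℝ)) ^ 2 := pow_le_pow_left₀ (Nat.cast_nonneg _) hM 2
      _ = x ^ (202 / 100 : ℝ) := by rw [← Real.rpow_natCast, ← Real.rpow_mul hqh0.le]; norm_num
  have hY1 : (1 : ℝ) ≤ x ^ (2 + η) := Real.one_le_rpow hqh1.le (by linarith)
  have hY : ((⌈x ^ (2 + η)⌉₊ : ℕ) : ℝ) ≤ 2 * x ^ (201 / 100 : ℝ) :=
    (natCeil_le_two_mul hY1).trans (mul_le_mul_of_nonneg_left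
      (Real.rpow_le_rpow_of_exponent_le hqh1.le (by linarith)) (by norm_num))
  calc _ ≤ x ^ (202 / 100 : ℝ) * (2 * x ^ (201 / 100 : ℝ)) :=
        mul_le_mul hM2 hY (Nat.cast_nonneg _) (Real.rpow_nonneg hqh0.le _)
    _ = 2 * x ^ (403 / 100 : ℝ) := by
        rw [show (403 / 100 : ℝ) = 202 / 100 + 201 / 100 by norm_num, Real.rpow_add hqh0]; ring

/-- **The exponent check for `k ≥ 1`**: `q̂^{2/100} · (2q̂^{403/100})^{k+1} ≤ 2^{k+1} · q^{2k+1} · r^{2k}` for `r > q̂^{11/10}`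
(`q ≥ q̂²`; `4.05 + 4.03k ≤ 6.2k + 2`). [folklore] -/
theorem higher_order_scale_le {q : ℕ} [NeZero q] (hq : 64 ≤ q) {k : ℕ} (hk : 1 ≤ k) {r : ℕ}
    (hr : KMV2000.qhat q ^ (11 / 10 : ℝ) < r) :
    KMV2000.qhat q ^ (2 / 100 : ℝ) * (2 * KMV2000.qhat q ^ (403 / 100 : ℝ)) ^ (k + 1) ≤
      2 ^ (k + 1) * ((q : ℝ) ^ (2 * k + 1) * (r : ℝ) ^ (2 * k)) := by
  have hqh1 : 1 < KMV2000.qhat q := one_lt_qhat hq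
  have hqh0 : 0 < KMV2000.qhat q := zero_lt_one.trans hqh1
  set x : ℝ := KMV2000.qhat q with hx
  have hk1 : (1 : ℝ) ≤ k := by exact_mod_cast hk
  have hr0 : (0 : ℝ) ≤ r := Nat.cast_nonneg r
  -- left side as one power of `x`
  have hl : x ^ (2 / 100 : ℝ) * (2 * x ^ (403 / 100 : ℝ)) ^ (k + 1) =
      2 ^ (k + 1) * x ^ (2 / 100 + 403 / 100 * ((k : ℝ) + 1)) := by
    rw [mul_pow, ← Real.rpow_natCast (x ^ (403 / 100 : ℝ)) (k + 1), ← Real.rpow_mul hqh0.le, Real.rpow_add hqh0]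
    push_cast
    ring
  -- right side bounded below by one power of `x`
  have hq2 : x ^ 2 ≤ (q : ℝ) := by rw [hx]; exact qhat_sq_le q
  have hqpow : x ^ (2 * ((2 * k + 1 : ℕ) : ℝ)) ≤ (q : ℝ) ^ (2 * k + 1) := by
    rw [Real.rpow_mul hqh0.le, Real.rpow_natCast, Real.rpow_two]
    exact pow_le_pow_left₀ (sq_nonneg _) hq2 _
  have hrpow : x ^ (11 / 10 * ((2 * k : ℕ) : ℝ)) ≤ (r : ℝ) ^ (2 * k) := by
    rw [Real.rpow_mul hqh0.le, Real.rpow_natCast]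
    exact pow_le_pow_left₀ (Real.rpow_nonneg hqh0.le _) hr.le _
  have hexp : 2 / 100 + 403 / 100 * ((k : ℝ) + 1) ≤ 2 * ((2 * k + 1 : ℕ) : ℝ) + 11 / 10 * ((2 * k : ℕ) : ℝ) := by
    push_cast
    nlinarith
  rw [hl]
  refine mul_le_mul_of_nonneg_left ?_ (by positivity)
  calc x ^ (2 / 100 + 403 / 100 * ((k : ℝ) + 1)) ≤ x ^ (2 * ((2 * k + 1 : ℕ) : ℝ) + 11 / 10 * ((2 * k : ℕ) : ℝ)) :=
        Real.rpow_le_rpow_of_exponent_le hqh1.le hexp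
    _ = x ^ (2 * ((2 * k + 1 : ℕ) : ℝ)) * x ^ (11 / 10 * ((2 * k : ℕ) : ℝ)) := Real.rpow_add hqh0 _ _
    _ ≤ (q : ℝ) ^ (2 * k + 1) * (r : ℝ) ^ (2 * k) :=
        mul_le_mul hqpow hrpow (Real.rpow_nonneg hqh0.le _) (by positivity)

/-! ## §2. Every Taylor order `k ≥ 1` is trivially small on a short window -/

/-- **The `k ≥ 1` forms need no cancellation.** For every `P`, `i, j`, `k ≥ 1`, `1 < Δ' ≤ 101/100` and `0 < η ≤ 1/100`
there are `A, q₀` with `Σ_{d₁,d₂ ≤ M} ‖Form_{ijk}(d₁,d₂;r)‖ ≤ A · q̂^{−1/100} · (qr)^{2k+2} · r⁻¹` for all `q ≥ q₀` and all layers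
`⌊q̂^{ρ_P}⌋ < r ≤ ⌊q̂^{ρ_W}⌋` (trivial bound `|S| ≤ qr`, `|x_m| ≤ Bm^{−1/2}`, `‖(N₁N₂)^{−1/2}W‖√(N₁N₂) ≪ L`). [folklore] -/
theorem sum_norm_form_le_of_one_le (P : ℝ[X]) (i j : ℕ) {k : ℕ} (hk : 1 ≤ k) {Δ' η : ℝ} (h1 : 1 < Δ')
    (h2 : Δ' ≤ 101 / 100) (hη0 : 0 ≤ η) (hη : η ≤ 1 / 100) :
    ∃ A : ℝ, ∃ q₀ : ℕ, ∀ (q : ℕ) [NeZero q], q.Prime → q₀ ≤ q → (∀ n : ℕ, (n : ℝ) ≠ KMV2000.qhat q ^ Δ') →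
      ∀ (r : ℕ) [NeZero (q * r)], r ∈ Icc (layerCount q rhoP Δ' + 1) (layerCount q rhoWeil Δ') →
        ∑ d₁ ∈ Icc 1 ⌊KMV2000.qhat q ^ Δ'⌋₊, ∑ d₂ ∈ Icc 1 ⌊KMV2000.qhat q ^ Δ'⌋₊,
          ‖∑ m₁ ∈ Icc 1 (⌊KMV2000.qhat q ^ Δ'⌋₊ / d₁), ∑ n₁ ∈ Icc 1 (q ^ 2 / d₁),
            ∑ m₂ ∈ Icc 1 (⌊KMV2000.qhat q ^ Δ'⌋₊ / d₂), ∑ n₂ ∈ Icc 1 (q ^ 2 / d₂),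
              ((KMV2000.mollifierCoeff P (KMV2000.qhat q ^ Δ') (d₁ * m₁) : ℂ) *
                  (KMV2000.mollifierCoeff P (KMV2000.qhat q ^ Δ') (d₂ * m₂) : ℂ) *
                  ((Real.sqrt m₁ ^ (2 * k + 1) * Real.sqrt m₂ ^ (2 * k + 1) : ℝ) : ℂ)) *
                ((if d₁ * n₁ * (d₂ * n₂) ≤ ⌈KMV2000.qhat q ^ (2 + η)⌉₊ then
                    ((((((d₁ * n₁ : ℕ) : ℝ) * ((d₂ * n₂ : ℕ) : ℝ)) ^ (-(1 / 2 : ℝ)) : ℝ) : ℂ) *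
                      afeW (KMV2000.qhat q) i j (d₁ * n₁) (d₂ * n₂)) else 0) *
                  ((Real.sqrt n₁ ^ (2 * k + 1) * Real.sqrt n₂ ^ (2 * k + 1) : ℝ) : ℂ)) *
                kloostermanSum (q * r) ((m₁ * n₁ : ℕ) : ZMod (q * r)) ((m₂ * n₂ : ℕ) : ZMod (q * r))‖ ≤
          A * KMV2000.qhat q ^ (-(1 / 100 : ℝ)) * ((q : ℝ) * r) ^ (2 * k + 2) * ((r : ℝ))⁻¹ := by
  have h0 : 0 < Δ' := by linarith
  set B : ℝ := ∑ i ∈ range (P.natDegree + 1), |P.coeff i| with hBdef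
  have hB : ∀ t ∈ Set.Icc (0 : ℝ) 1, |P.eval t| ≤ B := fun t ht ↦ abs_eval_le_sum_abs_coeff P ht
  have hB0 : 0 ≤ B := le_trans (abs_nonneg _) (hB 0 (by simp))
  obtain ⟨Kw, hKw0, hKw⟩ := weight_mul_sqrt_le_rpow i j (le_refl (0 : ℝ))
  obtain ⟨Cl, hCl0, hCl⟩ := logFactor_mul_le_rpow i j
  refine ⟨4 * (B ^ 2 * Kw * Cl) * 2 ^ (k + 1), 64, fun q _ _ h64 _ r _ hr ↦ ?_⟩
  have hqh1 : 1 < KMV2000.qhat q := one_lt_qhat h64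
  have hqh0 : 0 < KMV2000.qhat q := zero_lt_one.trans hqh1
  have hq0 : (0 : ℝ) < q := by exact_mod_cast lt_of_lt_of_le (by norm_num) h64
  have hrlo : KMV2000.qhat q ^ (11 / 10 : ℝ) < r := qhat_rpow_lt_of_mem_band h64 h1 (mem_Icc.mp hr).1
  have hrpos : (0 : ℝ) < r := lt_trans (Real.rpow_pos_of_pos hqh0 _) hrlo
  have htriv := sum_norm_form_le_trivial h64 hB h0 i j hKw0 (fun hN₁ hN₂ ↦ hKw h64 hN₁ hN₂) (r := r) k
    ⌈KMV2000.qhat q ^ (2 + η)⌉₊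
  have hlog := hCl q h64
  have hbox := box_product_le h64 h2 hη0 hη
  have hscale := higher_order_scale_le h64 hk hrlo
  set x : ℝ := KMV2000.qhat q with hx
  set L : ℝ := ((1 + Real.log x) * (1 + 2 * Real.log q)) ^ (i + j) with hL
  refine htriv.trans ?_
  have hbox0 : 0 ≤ (((⌊x ^ Δ'⌋₊ : ℕ) : ℝ)) ^ 2 * ((⌈x ^ (2 + η)⌉₊ : ℕ) : ℝ) := by positivity
  -- the trivial bound's right side against the target
  calc 4 * ((q : ℝ) * r) * (B ^ 2 * Kw * L * (1 + 2 * Real.log q)) *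
        ((((⌊x ^ Δ'⌋₊ : ℕ) : ℝ)) ^ 2 * ((⌈x ^ (2 + η)⌉₊ : ℕ) : ℝ)) ^ (k + 1)
      = 4 * ((q : ℝ) * r) * (B ^ 2 * Kw) * (L * (1 + 2 * Real.log q)) *
        ((((⌊x ^ Δ'⌋₊ : ℕ) : ℝ)) ^ 2 * ((⌈x ^ (2 + η)⌉₊ : ℕ) : ℝ)) ^ (k + 1) := by ring
    _ ≤ 4 * ((q : ℝ) * r) * (B ^ 2 * Kw) * (Cl * x ^ (1 / 100 : ℝ)) * (2 * x ^ (403 / 100 : ℝ)) ^ (k + 1) :=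
        mul_le_mul (mul_le_mul_of_nonneg_left hlog (by positivity)) (pow_le_pow_left₀ hbox0 hbox _)
          (by positivity) (by positivity)
    _ = 4 * (B ^ 2 * Kw * Cl) * ((q : ℝ) * r) * x ^ (-(1 / 100 : ℝ)) *
          (x ^ (2 / 100 : ℝ) * (2 * x ^ (403 / 100 : ℝ)) ^ (k + 1)) := by
        have e : x ^ (1 / 100 : ℝ) = x ^ (-(1 / 100 : ℝ)) * x ^ (2 / 100 : ℝ) := by
          rw [← Real.rpow_add hqh0]; norm_num
        rw [e]; ring
    _ ≤ 4 * (B ^ 2 * Kw * Cl) * ((q : ℝ) * r) * x ^ (-(1 / 100 : ℝ)) *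
          (2 ^ (k + 1) * ((q : ℝ) ^ (2 * k + 1) * (r : ℝ) ^ (2 * k))) :=
        mul_le_mul_of_nonneg_left hscale (by positivity)
    _ = 4 * (B ^ 2 * Kw * Cl) * 2 ^ (k + 1) * x ^ (-(1 / 100 : ℝ)) * ((q : ℝ) * r) ^ (2 * k + 2) * ((r : ℝ))⁻¹ := by
        field_simp
        ring

/-! ## §3. `stub_farP` from the leading Taylor order -/

/-- **`stub_farP`'s signature `SubFar rhoP` from the `k = 0` SEPARATED BILINEAR KLOOSTERMAN FORMS alone.**  If on a
window `(1, Δ₀] ⊆ (1, 101/100]`, for every admissible `P` and every `Δ'` in the window there are ONE `δ > 0` and ONE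
`η ∈ (0, 1/100]` such that for all `i, j` there are `A, q₀` with, for all primes `q ≥ q₀` (`q̂^{Δ'} ∉ ℕ`) and all layers
`⌊q̂^{ρ_P}⌋ < r ≤ ⌊q̂^{ρ_W}⌋`,
`Σ_{d₁,d₂ ≤ M} ‖Σ_{m₁'≤M/d₁,n₁'≤q²/d₁,m₂'≤M/d₂,n₂'≤q²/d₂} [x_{d₁m₁'}x_{d₂m₂'}√m₁'√m₂']
  [1_{d₁n₁'d₂n₂'≤Y}(d₁n₁'d₂n₂')^{−1/2}W_{ij}(q̂;d₁n₁',d₂n₂')√n₁'√n₂'] S(m₁'n₁', m₂'n₂'; qr)‖ ≤ A · q̂^{−δ} · (qr)² · r⁻¹`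
(`M = ⌊q̂^{Δ'}⌋`, `Y = ⌈q̂^{2+η}⌉`), then `SubFar rhoP` (`subFar_rhoP_of_form_bound`; the orders `k ≥ 1` by
`sum_norm_form_le_of_one_le`, with `δ ↦ min δ (1/100)`). [folklore] -/
theorem subFar_rhoP_of_form_bound_zero {Δ₀ : ℝ} (hΔ₀ : 1 < Δ₀) (hΔ₀' : Δ₀ ≤ 101 / 100)
    (h : ∀ P : ℝ[X], KMV2000.Admissible P → ∀ Δ' : ℝ, 1 < Δ' → Δ' ≤ Δ₀ →
      ∃ δ η : ℝ, 0 < δ ∧ 0 < η ∧ η ≤ 1 / 100 ∧ ∀ i j : ℕ, ∃ A : ℝ, ∃ q₀ : ℕ,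
        ∀ (q : ℕ) [NeZero q], q.Prime → q₀ ≤ q → (∀ n : ℕ, (n : ℝ) ≠ KMV2000.qhat q ^ Δ') →
        ∀ (r : ℕ) [NeZero (q * r)], r ∈ Icc (layerCount q rhoP Δ' + 1) (layerCount q rhoWeil Δ') →
          ∑ d₁ ∈ Icc 1 ⌊KMV2000.qhat q ^ Δ'⌋₊, ∑ d₂ ∈ Icc 1 ⌊KMV2000.qhat q ^ Δ'⌋₊,
            ‖∑ m₁ ∈ Icc 1 (⌊KMV2000.qhat q ^ Δ'⌋₊ / d₁), ∑ n₁ ∈ Icc 1 (q ^ 2 / d₁),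
              ∑ m₂ ∈ Icc 1 (⌊KMV2000.qhat q ^ Δ'⌋₊ / d₂), ∑ n₂ ∈ Icc 1 (q ^ 2 / d₂),
                ((KMV2000.mollifierCoeff P (KMV2000.qhat q ^ Δ') (d₁ * m₁) : ℂ) *
                    (KMV2000.mollifierCoeff P (KMV2000.qhat q ^ Δ') (d₂ * m₂) : ℂ) *
                    ((Real.sqrt m₁ * Real.sqrt m₂ : ℝ) : ℂ)) *
                  ((if d₁ * n₁ * (d₂ * n₂) ≤ ⌈KMV2000.qhat q ^ (2 + η)⌉₊ then
                      ((((((d₁ * n₁ : ℕ) : ℝ) * ((d₂ * n₂ : ℕ) : ℝ)) ^ (-(1 / 2 : ℝ)) : ℝ) : ℂ) *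
                        afeW (KMV2000.qhat q) i j (d₁ * n₁) (d₂ * n₂)) else 0) *
                    ((Real.sqrt n₁ * Real.sqrt n₂ : ℝ) : ℂ)) *
                  kloostermanSum (q * r) ((m₁ * n₁ : ℕ) : ZMod (q * r)) ((m₂ * n₂ : ℕ) : ZMod (q * r))‖ ≤
            A * KMV2000.qhat q ^ (-δ) * ((q : ℝ) * r) ^ 2 * ((r : ℝ))⁻¹) :
    SubFar rhoP := by
  refine subFar_rhoP_of_form_bound hΔ₀ (by linarith) fun P hP Δ' h1 h2 ↦ ?_
  obtain ⟨δ, η, hδ, hη, hη100, h0⟩ := h P hP Δ' h1 h2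
  have h2' : Δ' ≤ 101 / 100 := h2.trans hΔ₀'
  refine ⟨min δ (1 / 100), η, lt_min hδ (by norm_num), hη, by linarith, fun i j k ↦ ?_⟩
  rcases Nat.eq_zero_or_pos k with rfl | hk
  · -- the leading order: the hypothesis
    obtain ⟨A, q₀, hA⟩ := h0 i j
    refine ⟨|A|, max q₀ 64, fun q _ hq hq₀ hM r _ hr ↦ ?_⟩
    have h64 : 64 ≤ q := le_trans (le_max_right _ _) hq₀
    have hqh1 : 1 < KMV2000.qhat q := one_lt_qhat h64
    have hqh0 : 0 < KMV2000.qhat q := zero_lt_one.trans hqh1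
    have hAq := hA q hq (le_trans (le_max_left _ _) hq₀) hM r hr
    simp only [mul_zero, zero_add, pow_one]
    refine hAq.trans ?_
    have hmono : KMV2000.qhat q ^ (-δ) ≤ KMV2000.qhat q ^ (-min δ (1 / 100)) :=
      Real.rpow_le_rpow_of_exponent_le hqh1.le (by linarith [min_le_left δ (1 / 100)])
    exact mul_le_mul_of_nonneg_right (mul_le_mul_of_nonneg_right
      (mul_le_mul (le_abs_self A) hmono (Real.rpow_nonneg hqh0.le _) (abs_nonneg A)) (by positivity))
      (by positivity)
  · -- the higher orders: trivially small
    obtain ⟨A, q₀, hA⟩ := sum_norm_form_le_of_one_le P i j hk h1 h2' hη.le hη100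
    refine ⟨|A|, max q₀ 64, fun q _ hq hq₀ hM r _ hr ↦ ?_⟩
    have h64 : 64 ≤ q := le_trans (le_max_right _ _) hq₀
    have hqh1 : 1 < KMV2000.qhat q := one_lt_qhat h64
    have hqh0 : 0 < KMV2000.qhat q := zero_lt_one.trans hqh1
    have hAq := hA q hq (le_trans (le_max_left _ _) hq₀) hM r hr
    refine hAq.trans ?_
    have hmono : KMV2000.qhat q ^ (-(1 / 100 : ℝ)) ≤ KMV2000.qhat q ^ (-min δ (1 / 100)) :=
      Real.rpow_le_rpow_of_exponent_le hqh1.le (by linarith [min_le_right δ (1 / 100)])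
    exact mul_le_mul_of_nonneg_right (mul_le_mul_of_nonneg_right
      (mul_le_mul (le_abs_self A) hmono (Real.rpow_nonneg hqh0.le _) (abs_nonneg A)) (by positivity))
      (by positivity)

end Summit.Parity.GeneralizedHardyLittlewood.Theorems.MomentsBeyondDiagonal.Layers

end
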